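import Summits.QuantumFields.GaugeBoot.DiagonalRPTorusHexCheckerR
import Summits.QuantumFields.GaugeBoot.DiagonalRPTorusHexLocalRestOdd
import Summits.QuantumFields.GaugeBoot.DiagonalRPTorusHexCert
import HarnessLib

/-!
# The forest-split certificate for ODD tori (gauge-boot, L3 `d = 3` uniform window, odd leg, brick 3)

HONEST FRAMING (cell `pub-gaugeboot`, page 1 of every file): the venture produces certified bounds
on lattice expectations at stated coupling, gauge group, dimension and torus size; NOT a mass gap,
NOT a continuum limit, NOT a string tension; NOT Yang–Mills-summit-bearing (barriers
`FixedCouplingUltralocality`, `PerturbativeInvisibility`). This module is a KERNEL-CHECKED FINITE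
CERTIFICATE for a structural NEGATIVE result (a coupling window UNIFORM in the torus size for the
failure of closed-half diagonal reflection positivity on `(ℤ/L)^3`, `L` odd); it discharges
nothing by itself.

## Content (local chart at the base `y` of the hexagon, on the last layer `c` of the closed half)

On an odd torus the mirror-image hexagon sits ONE cube across the cut (`θy₀ = y + e₀`), so the
joining annulus is shorter: `LE₁odd` — the links of `θγ_{y₀}`; `LE₂` — those of `γ_y` (as in the
even leg); `tubeTodd` — the SIX-FACE ANNULUS (the faces of the `2×1×1` box `y + [0,2]×[0,1]×[0,1]`
other than the four hexagon faces).

* `hexCertOdd` — a decision tree (19 nodes; `HOME/pub-gaugeboot-lean3/gen47/tools/j1_tree_odd.py`)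
  and ★★ **`checkR_hexCertOdd : checkR lrestOdd LE₁odd LE₂ tubeTodd 6 4 hexCertOdd [] [] = true`**
  by `decide +kernel`: every set of at most six rest plaquettes around the pair is the annulus or
  has a forest split (brick 4 states it on the torus).
* `inBox_LE₁odd`, `inBox_tubeTodd`.

Standard axioms only.
-/

namespace Summit.QuantumFields.GaugeBoot

namespace DiagRPHex

/-- The links of the mirror-image hexagon `θγ_{y₀}` (`θy₀ = y + e₀`), in the chart at `y`. -/
def LE₁odd : List LEdge :=
  [((1, 0, 0), 2), ((1, 0, 1), 0), ((2, 0, 1), 1), ((2, 1, 0), 2), ((2, 0, 0), 1), ((1, 0, 0), 0)]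

/-- The six-face annulus between the two hexagons on an odd torus. -/
def tubeTodd : List LPlaq :=
  [((0, 0, 0), 0), ((1, 0, 0), 0), ((0, 0, 1), 0), ((1, 0, 1), 0), ((0, 0, 0), 1), ((1, 1, 0), 1)]

/-- The decision-tree certificate for odd tori (9 branchings, 9 split leaves, one tube leaf). -/
def hexCertOdd : Cert :=
  (.br ((1, 0, 1), 0)
   (.br ((1, 0, 0), 0)
    (.br ((0, 0, 1), 0)
     (.br ((0, 0, 0), 0)
      (.br ((1, 1, 0), 1)
       (.br ((1, 0, 0), 2) (.sp false [])
        (.br ((0, 0, 0), 1) .tube (.sp true [])))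
       (.br ((2, 1, 0), 2)
        (.br ((1, 0, 0), 2) (.sp false []) (.sp false []))
        (.sp true [])))
      (.sp false []))
     (.sp false []))
    (.sp true []))
   (.sp true []))

/-- ★★ **The odd certificate checks** (kernel evaluation of `DiagRPHex.checkR` with the odd rest test). -/
theorem checkR_hexCertOdd : checkR lrestOdd LE₁odd LE₂ tubeTodd 6 4 hexCertOdd [] [] = true := by
  decide +kernel

/-- The links of `LE₁odd` lie in the box of radius `4`. -/
theorem inBox_LE₁odd : ∀ e ∈ LE₁odd, InBox 4 e.1 := by
  have h : (LE₁odd.all fun e => inBoxB 4 e.1) = true := by decide +kernel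
  exact fun e he => inBox_of_inBoxB ((List.all_eq_true.1 h) e he)

/-- The odd annulus lies in the box of radius `4`. -/
theorem inBox_tubeTodd : ∀ p ∈ tubeTodd, InBox 4 p.1 := by
  have h : (tubeTodd.all fun p => inBoxB 4 p.1) = true := by decide +kernel
  exact fun p hp => inBox_of_inBoxB ((List.all_eq_true.1 h) p hp)

end DiagRPHex

end Summit.QuantumFields.GaugeBoot
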